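import Summits.BirchSwinnertonDyer.Rank1Residual.Supersingular.MazurTateConstantTermsMu
import Summits.BirchSwinnertonDyer.Rank1Residual.Supersingular.SignedLambdaParity
import Summits.BirchSwinnertonDyer.Rank1Residual.Supersingular.KobayashiMainConjecture
import Summits.BirchSwinnertonDyer.Rank1Residual.Supersingular.SprungPollackConsistency
import HarnessLib

/-!
# The Perrin-Riou–Pollack conjecture `μ(L♯) = μ(L♭) = 0` (`μ(L_p^±) = 0` at `a_p = 0`) on the good
# supersingular axis X6 / X7 / X8, typed as ONE `@[conjecture]` node on the tree's REAL objects, with its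
# census EVIDENCE, the kernel consequences, and the unit case in which it is a THEOREM
# (cell `b2b-bsdres`, lane CLASS-CLOSURE, typer of record cc-typer-5 GEN 5 for N4 §3.16 / N5·O4 §3.11 /
# N6·O3 §3.12; E1 items of the class leads additive-p3 GEN 16–18 (`N6/STATEMENT.md` E1 (a)+(b),
# `N5/WEEK-2026-08-28.md` §7 (ii)) — unit literature-prover-b2b-bsdres-cc-typer-5-g5-0, 2026-08-21)

HONEST FRAMING (run/shared/lean/b2b/bsd-rank1-residual/, verbatim): prove what is provable now; shrink each
hard class to its core with data; no claim beyond stated classes.  This file declares ONE conjecture node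
(`@[conjecture] def`, EVIDENCE-labelled: a conjecture IN PRINT, read on the tree's objects) and proves
THEOREMS about it; nothing about any curve is asserted, nothing is booked, no mark of `RESIDUAL-MAP.md`
moves, X6/X7/X8 stay CONSTRUCTION-SHAPED; 0 named Literature facts.  Census numbers are EVIDENCE recomputed
by the typer from the raw rows (referee rule R-CC (a)); certificates are instrumentation.  `μ = 0` is an
IWASAWA-INVARIANT statement, NOT a BSD₃ statement: the `p`-part of BSD on these classes needs the lower
divisibility (MC↓) (`KobayashiLowerDivisibility`, `SignedDatum.LowerDivisibility`), which no `μ`/`λ` value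
implies (class lead, `N6/STATEMENT.md`).

## The node (DEDUP: one statement for the three classes; the class leads' names are readings of it)

`SignedMuVanishing W p`: for `f` the newform of `E = W` at the conductor level and ANY Sprung pair
`(L♯, L♭)` of `f` at `p` (`Sprung2017.IsSprungPair`, = THE pair by `IsSprungPair.unique`; at `a_p = 0` it
is Pollack's `(L⁺, L⁻)` with the tree's labelling, `isSprungPair_zero_iff`), BOTH colours are non-zero
with `μ = 0`.  Printed antecedent: Perrin-Riou, Experiment. Math. 12 (2003) §6.1, Conjecture 6.1.1 —
"Les invariants `μ₊` et `μ₋` de `L_p(E/ℚ)` sont nuls" (her §6 keeps `a_p` in the layer recursion (6.1.1) and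
for `p = 3` her Table II consists of curves with `a_3 = 3`; she notes that in the supersingular case there is no
isogeny-invariance issue: `E` has no rational subgroup of order `p`), restated for Pollack's `L_p^±`
(`a_p = 0`) as "a well-known conjecture of B. Perrin-Riou and R. Pollack asserts that `μ_p^± = 0`"
(Gajek-Leonard, Canad. Math. Bull. 2025, §1; his Thm. 1.1 bounds `μ^±` by `1, 2, 3, p+1+⌈p/(p−1)⌉` when
`λ^± ∈ {0, 1}`, for all but finitely many `p`).  The class leads' E1 items are READINGS of this node:
`X8.mu_chromaticL_eq_zero` (N6 (a)) = `SignedMuVanishing W 3` on `ClassX8 W 3`;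
`X8.chromaticL_ne_zero` in positive rank (N6 (b), Sprung 2012 Conj. 6.15 / 2017 Conj. 4.12 shape) =
`SignedMuVanishing.chromaticL_ne_zero`; the N5/N4 "`μ^± = 0` item" = `SignedMuVanishing.kobayashiL_ne_zero_and_mu_eq_zero`
(Pollack pairs, Kobayashi's labelling).  Not typed (declined, with reason): the census-fittable `λ`-LAW
"`λ• = r_an` on a density-one set" (Kundu–Ray) — an Iwasawa-invariant statistic, not a class statement.

## What is PROVED here (kernel; all one-line delegations to the supersingular family's theorems)

* `SignedMuVanishing.chromaticL_ne_zero` — the node implies "both `L♯`, `L♭ ≠ 0`" in ANY rank (in rank 0 this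
  is already a theorem: `ClassX8/X7/X6.chromaticL_ne_zero_of_analyticRank_eq_zero`, Sprung Prop. 6.14);
* `SignedMuVanishing.even_lam_iff_even_analyticRank` (+ `odd_lam_of_analyticRank_eq_one`,
  `even_lam_of_analyticRank_eq_zero`) — granted the node, the PARITY `λ(L•) ≡ ord_{s=1} L(E,s) (mod 2)` of
  `SignedLambdaParity` holds with no residual `μ`/non-vanishing binder;
* `SignedMuVanishing.lam_mazurTate_eq_sharp/flat` — granted the node, an integral Mazur–Tate element `θ_n`
  of the matching parity has `μ(θ_n) = 0`, `λ(θ_n) = λ(L•) + deg ω_n^±` at EVERY layer with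
  `λ(L•) + deg ω_n^± < pⁿ` (the FAITHFUL range), and `θ_n ≡ 0 (mod p)` at every layer with
  `λ(L•) + deg ω_n^± ≥ pⁿ` (`…mazurTate_eq_zero_or_mu_pos_…`): SO A LAYER READING `μ(θ_n) ≥ 1` BELOW THE
  FAITHFUL RANGE CARRIES NO INFORMATION ABOUT `μ(L•)` — the kernel form of the census artefact below;
* `SignedMuVanishing.kobayashiL_ne_zero_and_mu_eq_zero` — at `a_p = 0` the node gives `μ(L_p^ε) = 0`,
  `L_p^ε ≠ 0` for every Pollack pair and both signs (Kobayashi's labelling `kobayashiL`);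
* THE UNIT CASE IS A THEOREM: `ClassX8.signedMuVanishing_of_padicValRat_ratPlusSymbol_eq_zero` and
  `signedMuVanishing_of_frobeniusTrace_eq_zero` — `ord_p([0]⁺_f) = 0` (`L(E,1)/Ω⁺_f` a `p`-unit; rank 0)
  ⟹ `SignedMuVanishing W p` on X8 resp. at `a_p = 0` (`ClassX8.isUnit_chromaticL`,
  `isUnit_chromaticL_of_frobeniusTrace_eq_zero`; Kurihara's pattern).

## EVIDENCE (recomputed by the typer from the raw rows; files of record of unit b2b-bsdres-iw-2)

WINDOW `N < 2·10⁴` (`HOME/b2b-bsdres-iw-2/tables/ss_signed_by_epsilon.tsv`, sha256 a13af7ec57c8a652…,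
two engines A = PARI `ellpadiclambdamu`, B = stdlib modular symbols): `μ^{+1} = μ^{−1} = 0` on **825 / 825**
pairs (X6 r0 168 · X7 r0 260 · X7 r1 72 · X8 r0 286 · X8 r1 39); engines agree 810/825, the 15 'differ' rows
are engine-B depth-limited high-`λ` rows (value of record engine A), none a `μ > 0` reading.  BEYOND THE
WINDOW `N < 5·10⁵` (`tables/ss500k_pairs.tsv`, sha256 8b51782e36b51cf4…, 12 541 rows, engine B, layers
`n ≤ 5` at `p = 3`): `μ` read at both parities on 9 087 pairs, `μ^± = 0` on **9 076** (X6 r0 733/734 · X7 r0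
2 286/2 286 · X7 r1 2 848/2 856 · X8 r0 2 205/2 205 · X8 r1 1 004/1 006); 3 454 rows unread (X7 r1 at
`p ≥ 7`, the 1 431 twist rows); engine T (PARI twisted `L`-values, no modular symbols) vs B on 8 933 pairs ×
19 836 layers: 0 disagreements (`czT_vs_B_ss500k_summary.json`).  The 11 rows with a `μ = 1` reading at one
parity: 9 UNSTABLE top layers at `p ∈ {7, 11}` (iw-2 `SS-SUPPORT-500K.md` (v): "NOT a certified value"), and
**2 X8 rank-1 rows flagged STABLE `(μ, λ − q_n) = (1, 1)` at both parities through `n = 5`: 224686b1@3,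
377881a1@3.  TYPER FINDING (this gen): both conductors contain the split multiplicative prime
`ℓ = 1459 = 1 + 2·3⁶` with `c_ℓ = v_ℓ(Δ) = 3`, totally split in `ℚ_n` for every computed layer `n ≤ 5`; the
three beyond-window rows with `ℓ = 163 = 1 + 2·3⁴`, `c_163 = 3` (157784i1 X7 r1, 198860a1 / 439774c1 X8 r1)
show the SAME reading `μ(θ_n) = 1`, `λ(θ_n) − q_n = 1` exactly for `n ≤ 3` (ℓ totally split) and `μ(θ_n) = 0`,
`λ(θ_n) − q_n ∈ {29, 31, 33}` at `n = 4, 5`, engine T concurring at `n = 1, 2, 3` on all five rows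
(`V = e_n + λ_B = 3, 9, 25`).**  By `lam_mazurTate_eq_of_lam_sharp/flat` and
`mazurTate_eq_zero_or_mu_pos_of_le_sharp/flat` these readings are EXACTLY those of `(μ•, λ•) = (0, 29)` resp.
`(0, 33/31)` (`29 + q_n ≥ 3ⁿ` for `n ≤ 3`, `< 3ⁿ` for `n = 4, 5`): a Tamagawa-3 split multiplicative prime that
is totally split in `ℚ_n` forces `3 ∣ θ_n` at those layers (`λ• ≥ 1 + s_ℓ` observed, `s_ℓ = 3^{v₃(ℓ−1)−1}` the
number of primes of `ℚ_∞` above `ℓ`; 28 = 1 + 27 for `ℓ = 163`), so the two `ℓ = 1459` rows are PSEUDO-STABLE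
(`s_ℓ = 243`; the faithful range starts at `n = 6` for `♭`, `n = 7` for `♯`), NOT `μ > 0` readings.
PRE-REGISTERED TEST (filed in `class-closure/N6/E1-MU-typer5.md` BEFORE any layer-`≥ 6` number exists; layers
6–7 of these two rows are a builders' run, engine B / PARI): GRANTED THE NODE, a certified reading `μ(θ_n) = 0`
pins `λ• = λ(θ_n) − q_n` and every HIGHER layer of the same parity then reads `μ = 0` too (`q_m − q_n < pᵐ − pⁿ`),
while a certified `μ(θ_n) ≥ 1` forces `λ• ≥ pⁿ − q_n`; so on 224686b1 / 377881a1 the node PREDICTS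
`λ♭ ≥ 61`, `λ♯ ≥ 183`, hence the first layer `m ≥ 6` that reads `μ(θ_m) = 0` shows `λ(θ_m) − q_m` ODD and
`≥ 61` (`m` even) / `≥ 183` (`m` odd) — the Tamagawa count sharpens this to `≥ 245 = 2 + 243` — and KILL =
on ANY row, a certified `μ(θ_n) = 0` followed at a higher layer of the same parity by a certified
`μ(θ_m) ≥ 1` (two engines), or on these two rows a `μ(θ_m) = 0` reading with `λ(θ_m) − q_m` even or below the
bound.  HELD-OUT VALIDATOR of record for `μ• = 0` itself: the kernel's one-value certificate
`|L•(ζ−1)|_p > 1/p ⟹ μ(L•) = 0 ∧ λ(L•) = φ·v_p` (`Iwasawa/LambdaInvariantValuation*`) at the first faithful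
layer.  Labels: EVIDENCE; nothing booked.

References: [PerrinRiou2003] §6.1 Conj. 6.1.1; [GajekLeonard2025] §1, Thm. 1.1; [Pollack2003] (the `L^±`;
locator via [GajekLeonard2025] §1, source not held); [Sprung2017] §3.1, Thm. 1.12, Cor. 1.8; [Kurihara2002]
Thm. 0.1; [Kobayashi2003] (3.6); [GreenbergVatsal2000] p. 2 (2); class files `class-closure/N6/STATEMENT.md`,
`HOME/b2b-bsdres-additive-p3/g16/CLASS-CLOSURE-INPUT-addp3.md` §1 E1, `N5/WEEK-2026-08-28.md`.
-/

set_option autoImplicit false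

noncomputable section

open scoped Classical MatrixGroups ModularForm

open CongruenceSubgroup Polynomial WeierstrassCurve Literature.NumberTheory.EllipticCurves
  Literature.NumberTheory.EllipticCurves.ModularForms
  Literature.NumberTheory.EllipticCurves.Sprung2017
  Literature.NumberTheory.EllipticCurves.Rank1Residual
  Summit.BirchSwinnertonDyer.Rank1Residual.X1.MuLambda
  Summit.BirchSwinnertonDyer.Rank1Residual.Iwasawa

namespace Summit.BirchSwinnertonDyer.Rank1Residual.Supersingular

/-! ## §1. The node -/

section Node

/-- **TYPED CONJECTURE (EVIDENCE) — the Perrin-Riou–Pollack vanishing of the signed `μ`-invariants,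
`μ(L♯_p(E)) = μ(L♭_p(E)) = 0`.**  For a globally minimal `W` and a prime `p`: for `f ∈ S₂(Γ₀(N_W))` the
newform of `E = W` and every Sprung pair `(L♯, L♭) ∈ Λ²` of `f` at `p` for the trace `a_p(W)`
(`IsSprungPair f p a_p L♯ L♭`: `θ_n ≡ −(u_n L♯ + v_n L♭) (mod ω_n)` for all `n`), BOTH `L♯ ≠ 0 ∧ μ(L♯) = 0` and
`L♭ ≠ 0 ∧ μ(L♭) = 0` (`μ` = the tree's `MuLambda.mu`, junk on `0`, hence the non-vanishing clause).  Meant on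
the good supersingular axis (`GoodSS W p`, `p` odd), where the pair exists (`thm112_exists_isSprungPair`,
Pollack at `a_p = 0`) and is unique; elsewhere the node is not used.  In print as a CONJECTURE: Perrin-Riou
2003 Conj. 6.1.1 (`μ₊ = μ₋ = 0` for `L_p(E/ℚ)`, any supersingular `p`; her `p = 3` examples have `a_3 = 3`), for Pollack's
`L_p^±` (`a_p = 0`) "the conjecture of Perrin-Riou and Pollack `μ_p^± = 0`" (Gajek-Leonard 2025 §1, with the
bounds of his Thm. 1.1 as the only general result).  EVIDENCE and the pre-registered kill test: module
docstring (window 825/825 two-engine, beyond-window 9 076/9 087 engine-B readings `μ^± = 0`, the 11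
exceptions all UNREAD — 9 unstable, 2 pseudo-stable rows explained by a totally split Tamagawa-3 prime).
OPEN; nothing asserted; not a BSD₃ statement.
[cite: PerrinRiou2003, §6.1 Conjecture 6.1.1] [cite: GajekLeonard2025, §1 and Thm. 1.1]
[cite: Sprung2017, §3.1 and Thm. 1.12] -/
@[conjecture] def SignedMuVanishing (W : WeierstrassCurve ℚ) [W.IsElliptic] [W.IsGloballyMinimal]
    (p : ℕ) [Fact p.Prime] : Prop :=
  ∀ [NeZero (W.conductorNorm ℤ)] (f : CuspForm (Gamma0 (W.conductorNorm ℤ)) 2), IsNewformOf W f →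
    ∀ (Lsharp Lflat : IwasawaAlgebra p), IsSprungPair f p (W.frobeniusTrace p) Lsharp Lflat →
      ∀ c : Chroma, chromaticL c Lsharp Lflat ≠ 0 ∧ mu (chromaticL c Lsharp Lflat) = 0

end Node

/-! ## §2. Kernel consequences of the node -/

section Consequences

variable {W : WeierstrassCurve ℚ} [W.IsElliptic] [W.IsGloballyMinimal] {p : ℕ} [hp : Fact p.Prime]
  [NeZero (W.conductorNorm ℤ)] {f : CuspForm (Gamma0 (W.conductorNorm ℤ)) 2}
  {Lsharp Lflat : IwasawaAlgebra p}

/-- `L♯ ≠ 0 ∧ μ(L♯) = 0` from the node. [cite: PerrinRiou2003, §6.1 Conjecture 6.1.1] -/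
theorem SignedMuVanishing.sharp (h : SignedMuVanishing W p) (hf : IsNewformOf W f)
    (hSP : IsSprungPair f p (W.frobeniusTrace p) Lsharp Lflat) : Lsharp ≠ 0 ∧ mu Lsharp = 0 :=
  h f hf Lsharp Lflat hSP .sharp

/-- `L♭ ≠ 0 ∧ μ(L♭) = 0` from the node. [cite: PerrinRiou2003, §6.1 Conjecture 6.1.1] -/
theorem SignedMuVanishing.flat (h : SignedMuVanishing W p) (hf : IsNewformOf W f)
    (hSP : IsSprungPair f p (W.frobeniusTrace p) Lsharp Lflat) : Lflat ≠ 0 ∧ mu Lflat = 0 :=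
  h f hf Lsharp Lflat hSP .flat

/-- **The node implies "both `L♯` and `L♭` are non-zero" in ANY analytic rank** — the shape of Sprung's
Conjecture (JNT 2012 Conj. 6.15 / ANT 2017 Conj. 4.12; class lead's E1 item (b) `X8.chromaticL_ne_zero`);
in analytic rank `0` this is the THEOREM `ClassX8/X7/X6.chromaticL_ne_zero_of_analyticRank_eq_zero`.
[cite: PerrinRiou2003, §6.1 Conjecture 6.1.1] [cite: Sprung2017, Thm. 1.12 (notation)] -/
theorem SignedMuVanishing.chromaticL_ne_zero (h : SignedMuVanishing W p) (hf : IsNewformOf W f)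
    (hSP : IsSprungPair f p (W.frobeniusTrace p) Lsharp Lflat) (c : Chroma) :
    chromaticL c Lsharp Lflat ≠ 0 :=
  (h f hf Lsharp Lflat hSP c).1

/-- **Granted the node, `Even λ(L•) ↔ Even ord_{s=1} L(E,s)` with no residual binder** (`p` odd good
supersingular: `GoodSS W p`), from `even_lam_sharp/flat_iff_even_analyticRank`.
[cite: Ota2018, Prop. 5.16 and p. 498] [cite: PerrinRiou2003, §6.1 Conjecture 6.1.1] -/
theorem SignedMuVanishing.even_lam_iff_even_analyticRank (h : SignedMuVanishing W p) (hp2 : p ≠ 2)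
    (hss : GoodSS W p) (hf : IsNewformOf W f)
    (hSP : IsSprungPair f p (W.frobeniusTrace p) Lsharp Lflat) (c : Chroma) :
    Even (lam (chromaticL c Lsharp Lflat)) ↔ Even W.analyticRank := by
  cases c with
  | sharp =>
    obtain ⟨hL0, hμ⟩ := h.sharp hf hSP
    rw [chromaticL_sharp]
    exact even_lam_sharp_iff_even_analyticRank hp2 hf hss.1 hss.2 hSP hL0 hμ
  | flat =>
    obtain ⟨hL0, hμ⟩ := h.flat hf hSP
    rw [chromaticL_flat]
    exact even_lam_flat_iff_even_analyticRank hp2 hf hss.1 hss.2 hSP hL0 hμ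

/-- Granted the node: in analytic rank ONE both `λ(L♯)` and `λ(L♭)` are ODD (so `≥ 1`, never `2`).
[cite: Ota2018, Prop. 5.16 and p. 498] [cite: PerrinRiou2003, §6.1 Conjecture 6.1.1] -/
theorem SignedMuVanishing.odd_lam_of_analyticRank_eq_one (h : SignedMuVanishing W p) (hp2 : p ≠ 2)
    (hss : GoodSS W p) (h1 : W.analyticRank = 1) (hf : IsNewformOf W f)
    (hSP : IsSprungPair f p (W.frobeniusTrace p) Lsharp Lflat) (c : Chroma) :
    Odd (lam (chromaticL c Lsharp Lflat)) := by
  rw [← Nat.not_even_iff_odd, h.even_lam_iff_even_analyticRank hp2 hss hf hSP c, h1]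
  decide

/-- Granted the node: in analytic rank ZERO both `λ(L♯)` and `λ(L♭)` are EVEN.
[cite: Ota2018, Prop. 5.16 and p. 498] [cite: PerrinRiou2003, §6.1 Conjecture 6.1.1] -/
theorem SignedMuVanishing.even_lam_of_analyticRank_eq_zero (h : SignedMuVanishing W p) (hp2 : p ≠ 2)
    (hss : GoodSS W p) (h0 : W.analyticRank = 0) (hf : IsNewformOf W f)
    (hSP : IsSprungPair f p (W.frobeniusTrace p) Lsharp Lflat) (c : Chroma) :
    Even (lam (chromaticL c Lsharp Lflat)) := by
  rw [h.even_lam_iff_even_analyticRank hp2 hss hf hSP c, h0]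
  exact ⟨0, rfl⟩

/-- **Granted the node, SINGLE-LAYER EXACTNESS needs only the `λ`-range**: at an odd layer `n` with
`λ(L♯) + deg ω_n^+ < pⁿ` (the FAITHFUL range), every integral model `Θ` of `θ_n` has `Θ ≠ 0`, `μ(Θ) = 0`,
`λ(Θ) = λ(L♯) + deg ω_n^+`. [cite: Pollack2003, Prop. 6.9 and Prop. 6.10] [cite: Sprung2017, §3 and Cor. 3.6] -/
theorem SignedMuVanishing.lam_mazurTate_eq_sharp (h : SignedMuVanishing W p) (hp2 : p ≠ 2)
    (hss : GoodSS W p) (hf : IsNewformOf W f)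
    (hSP : IsSprungPair f p (W.frobeniusTrace p) Lsharp Lflat) {n : ℕ} (hn : Odd n)
    (hlt : lam Lsharp + (cyclotomicOmegaPlus p n).natDegree < p ^ n) {Θ : IwasawaAlgebra p}
    (hΘ : iwasawaToPowerSeries p Θ =
      ((mazurTateElement f p n).map (algebraMap ℚ ℚ_[p]) : PowerSeries ℚ_[p])) :
    Θ ≠ 0 ∧ mu Θ = 0 ∧ lam Θ = lam Lsharp + (cyclotomicOmegaPlus p n).natDegree :=
  lam_mazurTate_eq_of_lam_sharp hp2 hf hss.1 hss.2 hSP (h.sharp hf hSP).1 (h.sharp hf hSP).2 hn hlt hΘ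

/-- The same for `L♭` at even layers (`deg ω_n^-`). [cite: Pollack2003, Prop. 6.9 and Prop. 6.10] [cite: Sprung2017, §3 and Cor. 3.6] -/
theorem SignedMuVanishing.lam_mazurTate_eq_flat (h : SignedMuVanishing W p) (hp2 : p ≠ 2)
    (hss : GoodSS W p) (hf : IsNewformOf W f)
    (hSP : IsSprungPair f p (W.frobeniusTrace p) Lsharp Lflat) {n : ℕ} (hn : Even n)
    (hlt : lam Lflat + (cyclotomicOmegaMinus p n).natDegree < p ^ n) {Θ : IwasawaAlgebra p}
    (hΘ : iwasawaToPowerSeries p Θ =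
      ((mazurTateElement f p n).map (algebraMap ℚ ℚ_[p]) : PowerSeries ℚ_[p])) :
    Θ ≠ 0 ∧ mu Θ = 0 ∧ lam Θ = lam Lflat + (cyclotomicOmegaMinus p n).natDegree :=
  lam_mazurTate_eq_of_lam_flat hp2 hf hss.1 hss.2 hSP (h.flat hf hSP).1 (h.flat hf hSP).2 hn hlt hΘ

/-- **Granted the node, a layer BELOW the faithful range reads `θ_n ≡ 0 (mod p)`**: at an odd layer with
`λ(L♯) + deg ω_n^+ ≥ pⁿ`, every integral model of `θ_n` is `0` or has `μ ≥ 1` — so an engine reading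
`μ(θ_n) ≥ 1` there is what the NODE predicts for large `λ(L♯)` (the census artefact of the module docstring:
a totally split Tamagawa-`p` multiplicative prime makes `λ(L•)` large), not evidence against it.
[cite: Pollack2003, Prop. 6.9 and Prop. 6.10] -/
theorem SignedMuVanishing.mazurTate_eq_zero_or_mu_pos_sharp (h : SignedMuVanishing W p) (hp2 : p ≠ 2)
    (hss : GoodSS W p) (hf : IsNewformOf W f)
    (hSP : IsSprungPair f p (W.frobeniusTrace p) Lsharp Lflat) {n : ℕ} (hn : Odd n)
    (hge : p ^ n ≤ lam Lsharp + (cyclotomicOmegaPlus p n).natDegree) {Θ : IwasawaAlgebra p}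
    (hΘ : iwasawaToPowerSeries p Θ =
      ((mazurTateElement f p n).map (algebraMap ℚ ℚ_[p]) : PowerSeries ℚ_[p])) :
    Θ = 0 ∨ 0 < mu Θ :=
  mazurTate_eq_zero_or_mu_pos_of_le_sharp hp2 hf hss.1 hss.2 hSP (h.sharp hf hSP).1 (h.sharp hf hSP).2
    hn hge hΘ

/-- The same for `L♭` at even layers. [cite: Pollack2003, Prop. 6.9 and Prop. 6.10] -/
theorem SignedMuVanishing.mazurTate_eq_zero_or_mu_pos_flat (h : SignedMuVanishing W p) (hp2 : p ≠ 2)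
    (hss : GoodSS W p) (hf : IsNewformOf W f)
    (hSP : IsSprungPair f p (W.frobeniusTrace p) Lsharp Lflat) {n : ℕ} (hn : Even n)
    (hge : p ^ n ≤ lam Lflat + (cyclotomicOmegaMinus p n).natDegree) {Θ : IwasawaAlgebra p}
    (hΘ : iwasawaToPowerSeries p Θ =
      ((mazurTateElement f p n).map (algebraMap ℚ ℚ_[p]) : PowerSeries ℚ_[p])) :
    Θ = 0 ∨ 0 < mu Θ :=
  mazurTate_eq_zero_or_mu_pos_of_le_flat hp2 hf hss.1 hss.2 hSP (h.flat hf hSP).1 (h.flat hf hSP).2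
    hn hge hΘ

/-- **At `a_p = 0` (X6/X7) the node is Pollack's `μ(L_p^+) = μ(L_p^−) = 0`**: for every Pollack pair
`(L⁺, L⁻)` of the newform (`IsPollackPair`, = a Sprung pair for trace `0` by `isSprungPair_zero_iff`) and
both signs `ε`, Kobayashi's `L_p^ε` (`kobayashiL ε L⁺ L⁻`) is non-zero with `μ = 0` — the N5/O4 and N4
class leads' "`μ^± = 0` item". [cite: GajekLeonard2025, §1] [cite: Pollack2003, Prop. 6.18]
[cite: Kobayashi2003, (3.6) (p. 7)] -/
theorem SignedMuVanishing.kobayashiL_ne_zero_and_mu_eq_zero (h : SignedMuVanishing W p)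
    (hap : W.frobeniusTrace p = 0) (hf : IsNewformOf W f) {Lplus Lminus : IwasawaAlgebra p}
    (hL : IsPollackPair f p Lplus Lminus) (ε : ℤˣ) :
    kobayashiL ε Lplus Lminus ≠ 0 ∧ mu (kobayashiL ε Lplus Lminus) = 0 := by
  have hSP : IsSprungPair f p (W.frobeniusTrace p) Lplus Lminus := by
    rw [hap]
    exact (isSprungPair_zero_iff f p Lplus Lminus).mpr ⟨hL.2.2.1, hL.2.2.2⟩
  unfold kobayashiL
  split_ifs
  · exact h.flat hf hSP
  · exact h.sharp hf hSP

end Consequences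

/-! ## §3. The unit case: the node is a THEOREM when `ord_p([0]⁺_f) = 0` -/

section UnitCase

variable {W : WeierstrassCurve ℚ} [W.IsElliptic] [W.IsGloballyMinimal] {p : ℕ} [hp : Fact p.Prime]
  [NeZero (W.conductorNorm ℤ)] {f₀ : CuspForm (Gamma0 (W.conductorNorm ℤ)) 2}

/-- **X8, unit case: `ord_3([0]⁺_f) = 0 ⟹ SignedMuVanishing W 3`** (Kurihara's pattern on real objects:
both colours are UNITS of `Λ`, `ClassX8.isUnit_chromaticL`; the newform at the conductor level is unique,
`IsNewformOf.unique`).  On the census this is the rank-0 `v_3(L(E,1)/Ω) = 0` sub-class (window: 1 020/1 020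
layers read `(0, q_n)`). [cite: Kurihara2002, Thm. 0.1] [cite: Sprung2017, Cor. 4.11 (table of special values)] -/
theorem ClassX8.signedMuVanishing_of_padicValRat_ratPlusSymbol_eq_zero (hX : ClassX8 W p)
    (hf₀ : IsNewformOf W f₀) (hr : ratPlusSymbol f₀ 0 ≠ 0)
    (hv : padicValRat p (ratPlusSymbol f₀ 0) = 0) : SignedMuVanishing W p := by
  intro _ f hf Lsharp Lflat hSP c
  obtain rfl : f = f₀ := hf.unique hf₀
  have hu := (isUnit_iff_mu_eq_zero_and_lam_eq_zero _).mp (ClassX8.isUnit_chromaticL hX hf hSP c hr hv)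
  exact ⟨hu.1, hu.2.1⟩

/-- **`a_p = 0` (X6/X7), unit case: `p` odd good, `a_p = 0`, `ord_p([0]⁺_f) = 0 ⟹ SignedMuVanishing W p`**
(`isUnit_chromaticL_of_frobeniusTrace_eq_zero`: `c_♯ = p − 1`, `c_♭ = 2` are `p`-units).
[cite: Kurihara2002, Thm. 0.1] [cite: Kobayashi2003, (3.6) (p. 7)] -/
theorem signedMuVanishing_of_frobeniusTrace_eq_zero (hp2 : p ≠ 2) (hgood : W.HasGoodReductionAtPrime p)
    (hap : W.frobeniusTrace p = 0) (hf₀ : IsNewformOf W f₀) (hr : ratPlusSymbol f₀ 0 ≠ 0)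
    (hv : padicValRat p (ratPlusSymbol f₀ 0) = 0) : SignedMuVanishing W p := by
  intro _ f hf Lsharp Lflat hSP c
  obtain rfl : f = f₀ := hf.unique hf₀
  have hu := (isUnit_iff_mu_eq_zero_and_lam_eq_zero _).mp
    (isUnit_chromaticL_of_frobeniusTrace_eq_zero hp2 hf hgood hap hSP c hr hv)
  exact ⟨hu.1, hu.2.1⟩

end UnitCase

/-! ## §4. Class readings (the class leads' E1 item names) -/

section Readings

variable {W : WeierstrassCurve ℚ} [W.IsElliptic] [W.IsGloballyMinimal] {p : ℕ} [hp : Fact p.Prime]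
  [NeZero (W.conductorNorm ℤ)] {f : CuspForm (Gamma0 (W.conductorNorm ℤ)) 2}
  {Lsharp Lflat : IwasawaAlgebra p}

/-- **N6/O3 E1 item (a) `X8.mu_chromaticL_eq_zero` = the node read on X8**: granted `SignedMuVanishing W p`
on an X8 pair (`p = 3`, `a_3 = ±3`), `μ(L♯_3(E)) = μ(L♭_3(E)) = 0` and both are non-zero; with the kernel's
bound `ClassX8.mu_chromaticL_le` (`μ• ≤ ord_3[0]⁺_f` in rank 0) and §3 this is a theorem exactly on the unit
rows. EVIDENCE (X8): window 325/325 two-engine, beyond window 3 209/3 211 read, the 2 others pseudo-stable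
(module docstring). [cite: PerrinRiou2003, §6.1 Conjecture 6.1.1] -/
theorem X8.mu_chromaticL_eq_zero (h : SignedMuVanishing W p) (hX : ClassX8 W p) (hf : IsNewformOf W f)
    (hSP : IsSprungPair f p (W.frobeniusTrace p) Lsharp Lflat) (c : Chroma) :
    chromaticL c Lsharp Lflat ≠ 0 ∧ mu (chromaticL c Lsharp Lflat) = 0 ∧
      (W.analyticRank = 1 → Odd (lam (chromaticL c Lsharp Lflat))) := by
  obtain ⟨hp3, hss, -⟩ := hX
  subst hp3
  exact ⟨(h f hf Lsharp Lflat hSP c).1, (h f hf Lsharp Lflat hSP c).2,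
    fun h1 ↦ h.odd_lam_of_analyticRank_eq_one (by decide) hss h1 hf hSP c⟩

/-- **N5/O4 (X7) and N4 (X6) E1 item = the node read at `a_p = 0`**: granted `SignedMuVanishing W p` on a
good supersingular pair with `p` odd and `a_p = 0`, every Pollack pair has `μ(L_p^+) = μ(L_p^−) = 0`, both
non-zero, and `λ(L_p^ε) ≡ ord_{s=1} L(E,s) (mod 2)` for both signs. EVIDENCE (X6+X7): window 500/500
two-engine; beyond window X6 733/734 · X7 5 134/5 142 read (module docstring).
[cite: GajekLeonard2025, §1] [cite: PerrinRiou2003, §6.1 Conjecture 6.1.1] -/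
theorem X7.mu_signed_eq_zero (h : SignedMuVanishing W p) (hp2 : p ≠ 2) (hss : GoodSS W p)
    (hap : W.frobeniusTrace p = 0) (hf : IsNewformOf W f) {Lplus Lminus : IwasawaAlgebra p}
    (hL : IsPollackPair f p Lplus Lminus) (ε : ℤˣ) :
    kobayashiL ε Lplus Lminus ≠ 0 ∧ mu (kobayashiL ε Lplus Lminus) = 0 ∧
      (Even (lam (kobayashiL ε Lplus Lminus)) ↔ Even W.analyticRank) := by
  have hSP : IsSprungPair f p (W.frobeniusTrace p) Lplus Lminus := by
    rw [hap]
    exact (isSprungPair_zero_iff f p Lplus Lminus).mpr ⟨hL.2.2.1, hL.2.2.2⟩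
  refine ⟨(h.kobayashiL_ne_zero_and_mu_eq_zero hap hf hL ε).1,
    (h.kobayashiL_ne_zero_and_mu_eq_zero hap hf hL ε).2, ?_⟩
  unfold kobayashiL
  split_ifs
  · simpa only [chromaticL_flat] using h.even_lam_iff_even_analyticRank hp2 hss hf hSP .flat
  · simpa only [chromaticL_sharp] using h.even_lam_iff_even_analyticRank hp2 hss hf hSP .sharp

end Readings

end Summit.BirchSwinnertonDyer.Rank1Residual.Supersingular

end
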